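import Literature.Geometry.Riemannian.HeatKernelJointGradientContinuityAux
import HarnessLib

/-!
# Joint continuity of the base-point gradient of the heat kernel of a Ricci flow
# (Bamler 2020a, §2.3; used in Thm. 5.9 / Cor. 5.10)

R. Bamler, *Entropy and heat kernel bounds on a Ricci flow background*, arXiv:2008.07093 (2020a),
§2.3, works with the heat kernel `K(x,t;y,s)` of a Ricci flow on a closed manifold as a smooth
function of all its variables; §5 (Thm. 5.9, `□𝒩* ≤ 0`, and Cor. 5.10) integrates
`|∇_x K(x,t;·,s)|²/K` in the target point. The tree's kernel function
`K = hflow.heatKernelFn hh hR` (`RicciFlowHeatKernelFn.lean`) of a Ricci flow `hflow` on `[a, T]`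
of a `C^∞` family `hh` of Riemannian metrics `hR` on a closed connected manifold `M` is known to
be `C^∞` in the base point `(x, t)` for each FIXED `(y, s)`, `C^∞` in `(y, s)` for each fixed base
point, and jointly continuous. This file proves the joint regularity of the first base-point
derivatives:

* `continuousOn_gradSq_heatKernelFn_basePoint` — for `s ∈ (a, T)`,
  `((z, σ), y) ↦ |∇_z K(z,σ;y,s)|²_{g_σ}` is continuous on `(M × (s, T)) × M`.

Proof. In the chart `φ` at `z₀` with coordinate frame `∂ᵢ`,
`|∇u|²_{g_σ}(z) = ∑ᵢⱼ ĝ_σ^{ij}(φ z) ∂ᵢû(φ z) ∂ⱼû(φ z)` (`innerDual_mvfderiv_eq_sum_localFrame`),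
the inverse Gram matrix of the smooth family being continuous in `(e, σ)`
(`IsContMDiffFamilyOn.continuousOn_gram_chart_inv`). The partial derivatives
`D(e, σ, y) = ∂ᵢ|_e K(φ⁻¹ ·,σ;y,s)` are continuous in `(e, σ)` for fixed `y` (smoothness in the
base point) and equicontinuous in `y`, locally uniformly in `(e, σ)`: by the semigroup formula
`K(z,σ;y,s) − K(z,σ;y',s) = ∫ K(z,σ;w,r) (K(w,r;y,s) − K(w,r;y',s)) dg_r(w)` (`s < r < σ`) and
the uniform chart Lipschitz bound `|K(φ⁻¹(e + t bᵢ),σ;w,r) − K(φ⁻¹ e,σ;w,r)| ≤ C |t|` of the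
auxiliary file (Bamler's gradient estimate, Thm. 4.1, behind the strong Feller property),
`|D(e,σ,y) − D(e,σ,y')| ≤ C · vol_{g_r}(M) · sup_w |K(w,r;y,s) − K(w,r;y',s)|`
(`IsRicciFlow.abs_fderiv_heatKernelFn_symm_sub_le`), and the supremum tends to `0` as `y' → y`
(tube lemma). Hence `D` is jointly continuous (`IsRicciFlow.continuousAt_fderiv_heatKernelFn_symm`).

Everything is proved; no definitions, no named facts. What is NOT here: higher base-point
derivatives, the mixed smoothness of `K` in all variables, non-compact `M`.

## References

* R. H. Bamler, *Entropy and heat kernel bounds on a Ricci flow background*, arXiv:2008.07093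
  (2020), §2.3, §4.1 (Thm. 4.1), §5 (Thm. 5.9, Cor. 5.10). [Bamler2020Entropy]
-/

noncomputable section

open Bundle Set Function Filter Manifold MeasureTheory Measure TopologicalSpace
open scoped Manifold ContDiff Topology ENNReal NNReal

namespace Literature.Geometry.Riemannian

open Lorentzian Lorentzian.PseudoRiemannianMetric

/-! ### The inverse Gram matrix of a smooth family in a chart is continuous -/

section Family

variable {E : Type*} [NormedAddCommGroup E] [NormedSpace ℝ E]
  {H : Type*} [TopologicalSpace H] {I : ModelWithCorners ℝ E H}
  {M : Type*} [TopologicalSpace M] [ChartedSpace H M] [IsManifold I ∞ M]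
  {g : ℝ → PseudoRiemannianMetric I ∞ E (TangentSpace I : M → Type _)}

/-- **The inverse Gram matrix of a smooth family is continuous on `φ.target × ℝ`**:
`(e, σ) ↦ (ĝ_σ(∂ᵢ, ∂ⱼ)(φ⁻¹ e))⁻¹ᵢⱼ`, `φ = extChartAt I x₀`, `∂ᵢ` the coordinate frame of the
trivialization at `x₀` (smooth entries, `IsContMDiffFamilyOn.contDiffOn_gram_chart`, nonvanishing
determinant, `det_gram_comp_extChartAt_symm_ne_zero`). [folklore] -/
theorem IsContMDiffFamilyOn.continuousOn_gram_chart_inv (hg : IsContMDiffFamilyOn ∞ g univ)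
    (x₀ : M) {ι : Type*} [Fintype ι] [DecidableEq ι] (b : Module.Basis ι ℝ E) (i j : ι) :
    ContinuousOn (fun q : E × ℝ ↦ (Matrix.of fun i j ↦ (g q.2).val ((extChartAt I x₀).symm q.1)
      ((trivializationAt E (TangentSpace I) x₀).localFrame b i ((extChartAt I x₀).symm q.1))
      ((trivializationAt E (TangentSpace I) x₀).localFrame b j ((extChartAt I x₀).symm q.1)))⁻¹
        i j) ((extChartAt I x₀).target ×ˢ univ) := by
  intro q hq
  have hG : ∀ i j, ContDiffOn ℝ ∞ (fun q : E × ℝ ↦ (g q.2).val ((extChartAt I x₀).symm q.1)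
      ((trivializationAt E (TangentSpace I) x₀).localFrame b i ((extChartAt I x₀).symm q.1))
      ((trivializationAt E (TangentSpace I) x₀).localFrame b j ((extChartAt I x₀).symm q.1)))
      ((extChartAt I x₀).target ×ˢ univ) := fun i j ↦ hg.contDiffOn_gram_chart x₀ b i j
  have h := contMDiffWithinAt_matrix_inv (J := 𝓘(ℝ, E × ℝ)) (k := ∞)
    (A := fun q : E × ℝ ↦ Matrix.of fun i j ↦ (g q.2).val ((extChartAt I x₀).symm q.1)
      ((trivializationAt E (TangentSpace I) x₀).localFrame b i ((extChartAt I x₀).symm q.1))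
      ((trivializationAt E (TangentSpace I) x₀).localFrame b j ((extChartAt I x₀).symm q.1)))
    (s := (extChartAt I x₀).target ×ˢ univ) (x₀ := q)
    (fun i j ↦ contMDiffWithinAt_iff_contDiffWithinAt.2 (hG i j q hq))
    (det_gram_comp_extChartAt_symm_ne_zero b (g q.2) hq.1) i j
  exact (contMDiffWithinAt_iff_contDiffWithinAt.1 h).continuousWithinAt

end Family

/-! ### Joint continuity of the chart derivatives of the kernel -/

section HeatKernel

variable {m : ℕ} {H : Type*} [TopologicalSpace H]
  {I : ModelWithCorners ℝ (EuclideanSpace ℝ (Fin m)) H} [I.Boundaryless]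
  {M : Type*} [TopologicalSpace M] [ChartedSpace H M] [IsManifold I ∞ M]
  [T2Space M] [CompactSpace M] [SecondCountableTopology M] [MeasurableSpace M] [BorelSpace M]
  [PreconnectedSpace M]
  {h : ℝ → PseudoRiemannianMetric I ∞ (EuclideanSpace ℝ (Fin m)) (TangentSpace I : M → Type _)}
  {cov : ℝ → CovariantDerivative I (EuclideanSpace ℝ (Fin m)) (TangentSpace I : M → Type _)}
  {a T : ℝ}
  (hflow : IsRicciFlow h cov (Icc a T)) (hh : IsContMDiffFamilyOn ∞ h univ)
  (hR : ∀ r, (h r).IsRiemannian)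

/-- **Equicontinuity of the chart derivatives in the target point.** Let `a < s < r < σ < T`,
`φ = extChartAt I z₀`, `e ∈ φ.target`, a vector `v`, and suppose the uniform chart Lipschitz
bound `|K(φ⁻¹(e + t v),σ;w,r) − K(φ⁻¹ e,σ;w,r)| ≤ C |t|` for `|t| < ε` and all `w`. If
`|K(w,r;y,s) − K(w,r;y',s)| ≤ δ` for all `w`, then
`|∂_v|_e K(φ⁻¹ ·,σ;y,s) − ∂_v|_e K(φ⁻¹ ·,σ;y',s)| ≤ C δ vol_{g_r}(M)`: by the semigroup formula
the difference `e ↦ K(φ⁻¹ e,σ;y,s) − K(φ⁻¹ e,σ;y',s) = ∫ K(φ⁻¹ e,σ;w,r)(K(w,r;y,s) − K(w,r;y',s))`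
is `C δ vol(M)`-Lipschitz along `e + t v`, and the derivative of a Lipschitz function is bounded
by its constant. [cite: Bamler2020Entropy, §2.3] -/
theorem IsRicciFlow.abs_fderiv_heatKernelFn_symm_sub_le (z₀ : M) (v : EuclideanSpace ℝ (Fin m))
    {s r σ C ε : ℝ} (hC : 0 ≤ C) (hε : 0 < ε) (has : a < s) (hsr : s < r) (hrσ : r < σ)
    (hσT : σ < T) {e : EuclideanSpace ℝ (Fin m)} (he : e ∈ (extChartAt I z₀).target)
    (hU : ∀ ⦃t : ℝ⦄, |t| < ε → ∀ w : M,
      |hflow.heatKernelFn hh hR σ ((extChartAt I z₀).symm (e + t • v)) (w, r) -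
          hflow.heatKernelFn hh hR σ ((extChartAt I z₀).symm e) (w, r)| ≤ C * |t|)
    {y y' : M} {δ : ℝ}
    (hδ : ∀ w, |hflow.heatKernelFn hh hR r w (y, s) - hflow.heatKernelFn hh hR r w (y', s)| ≤ δ) :
    |fderiv ℝ (fun e ↦ hflow.heatKernelFn hh hR σ ((extChartAt I z₀).symm e) (y, s)) e v -
        fderiv ℝ (fun e ↦ hflow.heatKernelFn hh hR σ ((extChartAt I z₀).symm e) (y', s)) e v| ≤
      C * δ * (h r).riemVolume.real univ := by
  haveI : IsFiniteMeasure (h r).riemVolume := ⟨(h r).riemVolume_univ_lt_top⟩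
  set φ := extChartAt I z₀ with hφ
  set K := hflow.heatKernelFn hh hR with hK
  have hsT : s ∈ Ioo a T := ⟨has, hsr.trans (hrσ.trans hσT)⟩
  have hσ : σ ∈ Ioo s T := ⟨hsr.trans hrσ, hσT⟩
  have har : a < r := has.trans hsr
  have hσ' : σ ∈ Ioc a T := ⟨har.trans hrσ, hσT.le⟩
  have hr' : r ∈ Ioc a T := ⟨har, (hrσ.trans hσT).le⟩
  have hδ0 : 0 ≤ δ := (abs_nonneg _).trans (hδ y)
  -- differentiability of the two chart representatives at `e`
  have hd : ∀ y, DifferentiableAt ℝ (fun e ↦ K σ (φ.symm e) (y, s)) e := fun y ↦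
    hflow.differentiableAt_heatKernelFn_symm hh hR z₀ hsT y hσ he
  set U : EuclideanSpace ℝ (Fin m) → ℝ := fun e ↦ K σ (φ.symm e) (y, s) - K σ (φ.symm e) (y', s)
    with hUdef
  have hUd : HasDerivAt (fun t : ℝ ↦ U (e + t • v))
      (fderiv ℝ (fun e ↦ K σ (φ.symm e) (y, s)) e v -
        fderiv ℝ (fun e ↦ K σ (φ.symm e) (y', s)) e v) 0 := by
    have h1 := ((hd y).fun_sub (hd y')).hasFDerivAt.hasLineDerivAt (𝕜 := ℝ) v
    rw [fderiv_fun_sub (hd y) (hd y')] at h1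
    exact h1
  -- continuity of the factors of the semigroup integrand
  have hkc : ∀ z, Continuous fun w ↦ K σ z (w, r) := fun z ↦
    hflow.continuous_heatKernelFn_slice hh hR hσ' z ⟨har, hrσ⟩
  have hψ1 : ∀ y, Continuous fun w ↦ K r w (y, s) := fun y ↦
    hflow.continuous_heatKernelFn_basePoint_slice hh hR hr' (p := (y, s)) ⟨has, hsr⟩
  have hint : ∀ z y, Integrable (fun w ↦ K σ z (w, r) * K r w (y, s)) (h r).riemVolume :=
    fun z y ↦ ((hkc z).mul (hψ1 y)).integrable_of_hasCompactSupport
      (HasCompactSupport.of_compactSpace _)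
  have hint' : ∀ z, Integrable (fun w ↦ K σ z (w, r) * (K r w (y, s) - K r w (y', s)))
      (h r).riemVolume := fun z ↦
    ((hkc z).mul ((hψ1 y).sub (hψ1 y'))).integrable_of_hasCompactSupport
      (HasCompactSupport.of_compactSpace _)
  -- the semigroup representation of `U`
  have hrepr : ∀ e', U e' =
      ∫ w, K σ (φ.symm e') (w, r) * (K r w (y, s) - K r w (y', s)) ∂(h r).riemVolume := by
    intro e'
    have hsg : ∀ y, K σ (φ.symm e') (y, s) =
        ∫ w, K σ (φ.symm e') (w, r) * K r w (y, s) ∂(h r).riemVolume := fun y ↦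
      hflow.heatKernelFn_semigroup hh hR har hrσ hσT.le (φ.symm e') ⟨has, hsr⟩ y
    simp only [hUdef]
    rw [hsg y, hsg y', ← integral_sub (hint _ y) (hint _ y')]
    refine integral_congr_ae (Eventually.of_forall fun w ↦ ?_)
    ring
  -- `U` is `C δ vol(M)`-Lipschitz along `e + t v` near `t = 0`
  have hlip : ∀ᶠ t in 𝓝 (0 : ℝ), ‖U (e + t • v) - U (e + (0 : ℝ) • v)‖ ≤
      C * δ * (h r).riemVolume.real univ * ‖t - 0‖ := by
    filter_upwards [Metric.ball_mem_nhds (0 : ℝ) hε] with t ht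
    have ht' : |t| < ε := by simpa [Real.dist_eq] using ht
    rw [zero_smul, add_zero, sub_zero, Real.norm_eq_abs, Real.norm_eq_abs, hrepr, hrepr,
      ← integral_sub (hint' _) (hint' _)]
    have hbound : ∀ w, ‖K σ (φ.symm (e + t • v)) (w, r) * (K r w (y, s) - K r w (y', s)) -
        K σ (φ.symm e) (w, r) * (K r w (y, s) - K r w (y', s))‖ ≤ C * |t| * δ := by
      intro w
      rw [← sub_mul, norm_mul, Real.norm_eq_abs, Real.norm_eq_abs]
      exact mul_le_mul (hU ht' w) (hδ w) (abs_nonneg _) (by positivity)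
    have h1 := norm_integral_le_of_norm_le_const (μ := (h r).riemVolume)
      (Eventually.of_forall hbound)
    rw [Real.norm_eq_abs] at h1
    calc _ ≤ C * |t| * δ * (h r).riemVolume.real univ := h1
      _ = _ := by ring
  have key := hUd.le_of_lip' (by positivity) hlip
  rwa [Real.norm_eq_abs] at key

/-- **Joint continuity of the chart derivatives of the heat kernel in base point, base time and
target point** (the regularity behind Bamler 2020a, Thm. 5.9 / Cor. 5.10): for `a < s < σ₀ < T`,
`z₀, y₀ ∈ M`, `φ = extChartAt I z₀` and a vector `v`, the function
`((e, σ), y) ↦ ∂_v|_e K(φ⁻¹ ·,σ;y,s)` is continuous at `((φ z₀, σ₀), y₀)` — continuity in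
`(e, σ)` for fixed `y` (`IsRicciFlow.continuousOn_fderiv_heatKernelFn_symm`) and equicontinuity
in `y` (`IsRicciFlow.abs_fderiv_heatKernelFn_symm_sub_le` with the uniform chart Lipschitz bound
`IsRicciFlow.exists_forall_abs_heatKernelFn_symm_add_smul_sub_le` and the tube lemma).
[cite: Bamler2020Entropy, §2.3 and §4.1, Thm. 4.1] -/
theorem IsRicciFlow.continuousAt_fderiv_heatKernelFn_symm (z₀ : M) (v : EuclideanSpace ℝ (Fin m))
    {s σ₀ : ℝ} (hs : s ∈ Ioo a T) (hσ₀ : σ₀ ∈ Ioo s T) (y₀ : M) :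
    ContinuousAt (fun q : (EuclideanSpace ℝ (Fin m) × ℝ) × M ↦
        fderiv ℝ (fun e ↦ hflow.heatKernelFn hh hR q.1.2 ((extChartAt I z₀).symm e) (q.2, s))
          q.1.1 v) ((extChartAt I z₀ z₀, σ₀), y₀) := by
  set φ := extChartAt I z₀ with hφ
  set K := hflow.heatKernelFn hh hR with hK
  have he₀ : φ z₀ ∈ φ.target := φ.map_source (mem_extChartAt_source z₀)
  -- intermediate times `s < r < r₂ < σ₀`
  set r : ℝ := s + (σ₀ - s) / 4 with hrdef
  set r₂ : ℝ := s + (σ₀ - s) / 2 with hr₂def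
  have hsσ₀ : s < σ₀ := hσ₀.1
  have hsr : s < r := by rw [hrdef]; linarith
  have hrr₂ : r < r₂ := by rw [hrdef, hr₂def]; linarith
  have hr₂σ₀ : r₂ < σ₀ := by rw [hr₂def]; linarith
  have har : a < r := hs.1.trans hsr
  obtain ⟨C, ε, hC, hε, hIoo, hball, hU⟩ :=
    hflow.exists_forall_abs_heatKernelFn_symm_add_smul_sub_le hh hR z₀ v har hrr₂ hr₂σ₀ hσ₀.2
  haveI : IsFiniteMeasure (h r).riemVolume := ⟨(h r).riemVolume_univ_lt_top⟩
  set V : ℝ := (h r).riemVolume.real univ with hV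
  have hV0 : 0 ≤ V := measureReal_nonneg
  set D : (EuclideanSpace ℝ (Fin m) × ℝ) × M → ℝ := fun q ↦
    fderiv ℝ (fun e ↦ K q.1.2 (φ.symm e) (q.2, s)) q.1.1 v with hDdef
  set p₀ : (EuclideanSpace ℝ (Fin m) × ℝ) × M := ((φ z₀, σ₀), y₀) with hp₀
  change ContinuousAt D p₀
  rw [ContinuousAt, Metric.tendsto_nhds]
  intro η hη
  -- (1) continuity in `(e, σ)` at the fixed target point `y₀`
  have h1 : ∀ᶠ q in 𝓝 p₀, |D (q.1, y₀) - D p₀| < η / 2 := by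
    have hc : ContinuousAt (fun q' : EuclideanSpace ℝ (Fin m) × ℝ ↦ D (q', y₀)) (φ z₀, σ₀) :=
      (hflow.continuousOn_fderiv_heatKernelFn_symm hh hR z₀ v hs y₀).continuousAt
        (((isOpen_extChartAt_target z₀).prod isOpen_Ioo).mem_nhds ⟨he₀, hσ₀⟩)
    have h2 := (Metric.tendsto_nhds.1 hc) (η / 2) (half_pos hη)
    exact (continuous_fst.tendsto p₀).eventually h2
  -- (2) uniform smallness of `K(w,r;y,s) − K(w,r;y₀,s)` for `y` near `y₀`
  set δ : ℝ := η / (2 * (C * V + 1)) with hδdef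
  have hCV : 0 ≤ C * V := mul_nonneg hC hV0
  have hδ : 0 < δ := by positivity
  have h2 : ∀ᶠ q in 𝓝 p₀, ∀ w, |K r w (q.2, s) - K r w (y₀, s)| < δ := by
    have hΦ : Continuous fun p : M × M ↦ K r p.1 (p.2, s) :=
      (hflow.continuousOn_heatKernelFn hh hR ⟨har, (hrr₂.trans (hr₂σ₀.trans hσ₀.2)).le⟩)
        |>.comp_continuous (continuous_fst.prodMk (continuous_snd.prodMk continuous_const))
        fun p ↦ ⟨mem_univ _, mem_univ _, hs.1, hsr⟩
    have h3 := eventually_forall_abs_sub_lt_of_continuous_prod hΦ y₀ hδ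
    exact (continuous_snd.tendsto p₀).eventually h3
  -- (3) the base point and time stay in the neighbourhood of the uniform Lipschitz bound
  have h3 : ∀ᶠ q in 𝓝 p₀, q.1 ∈ Metric.ball (φ z₀) ε ×ˢ Ioo (σ₀ - ε) (σ₀ + ε) :=
    (continuous_fst.tendsto p₀).eventually ((Metric.isOpen_ball.prod isOpen_Ioo).mem_nhds
      ⟨Metric.mem_ball_self hε, by constructor <;> linarith⟩)
  filter_upwards [h1, h2, h3] with q hq1 hq2 hq3
  rw [Real.dist_eq]
  have hσ : q.1.2 ∈ Ioo r₂ T := hIoo hq3.2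
  have h4 : |D q - D (q.1, y₀)| ≤ C * δ * V :=
    hflow.abs_fderiv_heatKernelFn_symm_sub_le hh hR z₀ v hC hε hs.1 hsr (hrr₂.trans hσ.1) hσ.2
      (hball hq3.1) (fun t ht w ↦ (hU hq3.2 hq3.1 ht).2 w) (fun w ↦ (hq2 w).le)
  have h5 : C * δ * V < η / 2 := by
    have h6 : C * δ * V = η / 2 * (C * V / (C * V + 1)) := by
      rw [hδdef]
      field_simp
    rw [h6]
    have h7 : C * V / (C * V + 1) < 1 := (div_lt_one (by positivity)).2 (by linarith)
    exact mul_lt_of_lt_one_right (half_pos hη) h7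
  calc |D q - D p₀| ≤ |D q - D (q.1, y₀)| + |D (q.1, y₀) - D p₀| := abs_sub_le _ _ _
    _ < η / 2 + η / 2 := add_lt_add (h4.trans_lt h5) hq1
    _ = η := by ring

/-! ### Joint continuity of `|∇_z K(z,σ;y,s)|²` -/

/-- **Joint continuity of the base-point gradient square of the heat kernel** (Bamler 2020a,
§2.3; the regularity used in Thm. 5.9, `□𝒩* ≤ 0`, and Cor. 5.10): for a Ricci flow on `[a, T]`
of a `C^∞` family of Riemannian metrics on a closed connected manifold and `s ∈ (a, T)`, the
function `((z, σ), y) ↦ |∇_z K(z,σ;y,s)|²_{g_σ}` is continuous on `(M × (s, T)) × M`. In the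
chart at `z₀`: `|∇u|² = ∑ᵢⱼ ĝ_σ^{ij} ∂ᵢû ∂ⱼû` (`innerDual_mvfderiv_eq_sum_localFrame`) with the
inverse Gram matrix continuous in `(e, σ)` and the chart derivatives `∂ᵢ K(φ⁻¹ ·,σ;y,s)` jointly
continuous (`IsRicciFlow.continuousAt_fderiv_heatKernelFn_symm`).
[cite: Bamler2020Entropy, §2.3 and §5, Thm. 5.9] -/
theorem continuousOn_gradSq_heatKernelFn_basePoint {s : ℝ} (hs : s ∈ Ioo a T) :
    ContinuousOn (fun q : (M × ℝ) × M ↦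
        (h q.1.2).gradSq (fun z ↦ hflow.heatKernelFn hh hR q.1.2 z (q.2, s)) q.1.1)
      ((univ ×ˢ Ioo s T) ×ˢ univ) := by
  classical
  rintro ⟨⟨z₀, σ₀⟩, y₀⟩ ⟨⟨-, hσ₀⟩, -⟩
  set b : Module.Basis (Fin m) ℝ (EuclideanSpace ℝ (Fin m)) :=
    (EuclideanSpace.basisFun (Fin m) ℝ).toBasis with hb
  set φ := extChartAt I z₀ with hφ
  set K := hflow.heatKernelFn hh hR with hK
  have he₀ : φ z₀ ∈ φ.target := φ.map_source (mem_extChartAt_source z₀)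
  set p₀ : (M × ℝ) × M := ((z₀, σ₀), y₀) with hp₀
  set S : Set ((M × ℝ) × M) := (univ ×ˢ Ioo s T) ×ˢ univ with hS
  -- the chart derivatives, the inverse Gram matrix, and the chart map on the product
  set D : Fin m → (EuclideanSpace ℝ (Fin m) × ℝ) × M → ℝ := fun i q ↦
    fderiv ℝ (fun e ↦ K q.1.2 (φ.symm e) (q.2, s)) q.1.1 (b i) with hDdef
  set Gi : Fin m → Fin m → EuclideanSpace ℝ (Fin m) × ℝ → ℝ := fun i j q ↦
    (Matrix.of fun i j ↦ (h q.2).val (φ.symm q.1)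
      ((trivializationAt (EuclideanSpace ℝ (Fin m)) (TangentSpace I) z₀).localFrame b i
        (φ.symm q.1))
      ((trivializationAt (EuclideanSpace ℝ (Fin m)) (TangentSpace I) z₀).localFrame b j
        (φ.symm q.1)))⁻¹ i j with hGidef
  set ι : (M × ℝ) × M → (EuclideanSpace ℝ (Fin m) × ℝ) × M := fun q ↦ ((φ q.1.1, q.1.2), q.2)
    with hιdef
  have hι : ContinuousAt ι p₀ := by
    have h1 : ContinuousAt (fun q : (M × ℝ) × M ↦ φ q.1.1) p₀ :=
      (continuousAt_extChartAt (I := I) z₀).comp_of_eq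
        (continuousAt_fst.comp continuousAt_fst) rfl
    exact (h1.prodMk (continuousAt_snd.comp continuousAt_fst)).prodMk continuousAt_snd
  have hD : ∀ i, ContinuousAt (fun q ↦ D i (ι q)) p₀ := fun i ↦ by
    have h1 := (hflow.continuousAt_fderiv_heatKernelFn_symm hh hR z₀ (b i) hs hσ₀ y₀).comp_of_eq
      hι rfl
    exact h1
  have hG : ∀ i j, ContinuousAt (fun q ↦ Gi i j (ι q).1) p₀ := fun i j ↦ by
    have h1 := ((hh.continuousOn_gram_chart_inv z₀ b i j).continuousAt
      (((isOpen_extChartAt_target z₀).prod isOpen_univ).mem_nhds ⟨he₀, mem_univ _⟩)).comp_of_eq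
      hι.fst rfl
    exact h1
  have hsum : ContinuousAt (fun q ↦ ∑ i, ∑ j, Gi i j (ι q).1 * D i (ι q) * D j (ι q)) p₀ :=
    tendsto_finsetSum _ fun i _ ↦ tendsto_finsetSum _ fun j _ ↦ ((hG i j).mul (hD i)).mul (hD j)
  -- the chart formula for `|∇u|²` near `p₀`
  have hformula : ∀ q : (M × ℝ) × M, q.1.1 ∈ (chartAt H z₀).source → q.1.2 ∈ Ioo s T →
      (h q.1.2).gradSq (fun z ↦ K q.1.2 z (q.2, s)) q.1.1 =
        ∑ i, ∑ j, Gi i j (ι q).1 * D i (ι q) * D j (ι q) := by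
    rintro ⟨⟨z, σ⟩, y⟩ hz hσ
    have hz' : z ∈ φ.source := by simpa only [hφ, extChartAt_source] using hz
    have hf1 : MDifferentiableAt I 𝓘(ℝ, ℝ) (fun z ↦ K σ z (y, s)) z :=
      ((contMDiff_slice_of_contMDiffOn (u := fun t z ↦ K t z (y, s))
        (hflow.contMDiffOn_heatKernelFn_basePoint hh hR hs y) hσ) z).mdifferentiableAt (by simp)
    simp only [hGidef, hDdef, hιdef, PseudoRiemannianMetric.gradSq]
    rw [φ.left_inv hz']
    exact innerDual_mvfderiv_eq_sum_localFrame (h σ) b hz hf1 hf1 EventuallyEq.rfl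
      EventuallyEq.rfl
  have hev : ∀ᶠ q in 𝓝[S] p₀, q.1.1 ∈ (chartAt H z₀).source ∧ q.1.2 ∈ Ioo s T := by
    have h1 : ∀ᶠ q in 𝓝[S] p₀, q.1.1 ∈ (chartAt H z₀).source :=
      mem_nhdsWithin_of_mem_nhds
        ((continuous_fst.comp continuous_fst).continuousAt.preimage_mem_nhds
          ((chartAt H z₀).open_source.mem_nhds (mem_chart_source H z₀)))
    have h2 : ∀ᶠ q in 𝓝[S] p₀, q ∈ S := self_mem_nhdsWithin
    filter_upwards [h1, h2] with q hq1 hq2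
    exact ⟨hq1, hq2.1.2⟩
  refine hsum.continuousWithinAt.congr_of_eventuallyEq ?_
    (hformula p₀ (mem_chart_source H z₀) hσ₀)
  filter_upwards [hev] with q hq
  exact hformula q hq.1 hq.2

end HeatKernel

end Literature.Geometry.Riemannian

end
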